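import Literature.AlgebraicGeometry.Motives.SmoothHypersurfaceScheme
import Literature.AlgebraicGeometry.Motives.DworkFamily
import Literature.AlgebraicGeometry.Resolution.AlterationsStrictTransformModel
import HarnessLib

/-!
# Crux `PadicSemiregularLift.SemiregularSeedsOnAnchors` (stmt-HodgeConjecture-13941), line
# `gorenstein-ci-seeds`, stub S2 `stub_serreBundle_exists`: the concrete model of the hypersurface
# and the cover by `{fᵢ ≠ 0} ∪ {gᵢ ≠ 0}`

LOG (worker S2, 2026-08-16). Reductions of the setting of S2/S3 (`X` smooth projective of
dimension `4`, `ι : X ↪ ℙ⁵` a closed immersion onto `V₊(F)`) to concrete objects: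

* `exists_iso_of_range_eq` — two REDUCED closed subschemes of a scheme `P` (over any base `S`)
  with the same underlying set are isomorphic over `P` (uniqueness of the reduced induced
  structure, Hartshorne II Ex. 3.11 (d); tree: `Resolution.IsClosedImmersion.liftOfRange`);
* `exists_iso_hypersurface` — hence a smooth projective `X` with `im ι = V₊(F)` is, compatibly with
  `ι`, the tree's reduced hypersurface `SmoothHypersurface.hypersurface F` (`X` is reduced by
  `Motives.isReduced_of_smoothOfRelativeDimension`) — the registered sub-goal of this file;
* `exists_not_mem_or_not_mem_of_isNonsingularForm` — for `F = Σ fᵢ gᵢ` nonsingular, no prime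
  ideal missing a variable contains all the `fᵢ` and all the `gᵢ` (`∂ⱼF = Σ ∂ⱼfᵢ·gᵢ + fᵢ·∂ⱼgᵢ`);
  on `ℙᴺ`: the opens `{fᵢ ≠ 0}`, `{gᵢ ≠ 0}` cover projective space
  (`exists_not_mem_homogeneousIdeal`), the cover on which the Hartshorne–Serre bundle of
  `V₊(f) ⊂ V₊(F)` is trivialised.
-/

noncomputable section

-- `Summit.HodgeConjecture.HodgeConjecture.…` (summit = problem) duplicates a namespace component by design (D-0017).
set_option linter.dupNamespace false

open CategoryTheory AlgebraicGeometry
open Literature.AlgebraicGeometry.Motives Literature.AlgebraicGeometry.Resolution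

universe u v

namespace Summit.HodgeConjecture.HodgeConjecture.Theorems.SemiregularSeedsOnAnchors.GorensteinCiSeeds

/-! ## Uniqueness of the reduced closed subscheme with given support -/

section Reduced

/-- **Uniqueness of the reduced induced structure**: two closed immersions `ιX : X ↪ P`,
`ιY : Y ↪ P` over a base `S` with REDUCED sources and the same image are isomorphic over `P`
(each factors through the other by `IsClosedImmersion.liftOfRange`; the two composites are the
identity because closed immersions are monomorphisms). [cite: Hartshorne1977, II Ex. 3.11 (d)] -/
theorem exists_iso_of_range_eq {S : Scheme.{u}} {X Y P : Over S} [IsReduced X.left]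
    [IsReduced Y.left] (ιX : X ⟶ P) (ιY : Y ⟶ P) [IsClosedImmersion ιX.left]
    [IsClosedImmersion ιY.left] (h : Set.range ιX.left = Set.range ιY.left) :
    ∃ e : X ≅ Y, e.hom ≫ ιY = ιX := by
  have hXY : Set.range ιX.left ⊆ Set.range ιY.left := h.le
  have hYX : Set.range ιY.left ⊆ Set.range ιX.left := h.ge
  have facXY : IsClosedImmersion.liftOfRange ιY.left ιX.left hXY ≫ ιY.left = ιX.left :=
    IsClosedImmersion.liftOfRange_fac _ _ _
  have facYX : IsClosedImmersion.liftOfRange ιX.left ιY.left hYX ≫ ιX.left = ιY.left :=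
    IsClosedImmersion.liftOfRange_fac _ _ _
  have hid₁ : IsClosedImmersion.liftOfRange ιY.left ιX.left hXY ≫
      IsClosedImmersion.liftOfRange ιX.left ιY.left hYX = 𝟙 _ := by
    rw [← cancel_mono ιX.left, Category.assoc, facYX, facXY, Category.id_comp]
  have hid₂ : IsClosedImmersion.liftOfRange ιX.left ιY.left hYX ≫
      IsClosedImmersion.liftOfRange ιY.left ιX.left hXY = 𝟙 _ := by
    rw [← cancel_mono ιY.left, Category.assoc, facXY, facYX, Category.id_comp]
  have wXY : IsClosedImmersion.liftOfRange ιY.left ιX.left hXY ≫ Y.hom = X.hom := by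
    rw [← Over.w ιY, ← Category.assoc, facXY, Over.w ιX]
  refine ⟨Over.isoMk ⟨IsClosedImmersion.liftOfRange ιY.left ιX.left hXY,
    IsClosedImmersion.liftOfRange ιX.left ιY.left hYX, hid₁, hid₂⟩ wXY, ?_⟩
  ext : 1
  rw [Over.comp_left]
  exact facXY

/-- **The concrete model of `X`**: a smooth projective `k`-scheme `X` with a closed `k`-immersion
`ι : X ↪ ℙⁿ⁺¹_k` onto `V₊(F)` is isomorphic, compatibly with `ι`, to the reduced hypersurface
`SmoothHypersurface.hypersurface F ↪ ℙⁿ⁺¹_k` of the tree (`X` is reduced, being smooth over `k`: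
`Motives.isReduced_of_smoothOfRelativeDimension`; then `exists_iso_of_range_eq`). [folklore] -/
theorem exists_iso_hypersurface :
    ∀ (k : Type u) [Field k] (n : ℕ) (F : MvPolynomial (Fin (n + 2)) k) (X : SchemeOver k)
      (_ : IsSmoothProjective n X) (ι : X ⟶ projectiveSpace (n + 1) k) [IsClosedImmersion ι.left]
      (_ : Set.range ι.left.base =
        @ProjectiveSpectrum.zeroLocus _ _ _ _ _ (MvPolynomial.homogeneousSubmodule (Fin (n + 2)) k)
          MvPolynomial.gradedAlgebra {F}),
      ∃ e : X ≅ SmoothHypersurface.hypersurface F,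
        e.hom ≫ SmoothHypersurface.hypersurfaceι F = ι := by
  intro k _ n F X hX ι _ hι
  letI := MvPolynomial.gradedAlgebra (σ := Fin (n + 2)) (R := k)
  haveI : SmoothOfRelativeDimension n X.hom := hX.smoothOfRelativeDimension
  haveI : IsReduced X.left := isReduced_of_smoothOfRelativeDimension X.hom n
  refine exists_iso_of_range_eq ι (SmoothHypersurface.hypersurfaceι F) ?_
  rw [SmoothHypersurface.range_hypersurfaceι]
  exact hι

end Reduced

/-! ## The cover `{fᵢ ≠ 0} ∪ {gᵢ ≠ 0}` of projective space for a nonsingular `F = Σ fᵢ gᵢ` -/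

section Cover

variable {k : Type u} [Field k] {n : ℕ} {ι : Type v} [Fintype ι]

/-- For `F = Σ fᵢ gᵢ`: `∂ⱼ F = Σᵢ (∂ⱼ fᵢ · gᵢ + fᵢ · ∂ⱼ gᵢ)` lies in any ideal containing all `fᵢ`
and all `gᵢ`. [folklore] -/
theorem pderiv_sum_mul_mem {𝔭 : Ideal (MvPolynomial (Fin (n + 2)) k)}
    (f g : ι → MvPolynomial (Fin (n + 2)) k) (hf : ∀ i, f i ∈ 𝔭) (hg : ∀ i, g i ∈ 𝔭)
    (j : Fin (n + 2)) : MvPolynomial.pderiv j (∑ i, f i * g i) ∈ 𝔭 := by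
  rw [map_sum]
  refine Ideal.sum_mem _ fun i _ => ?_
  rw [Derivation.leibniz, smul_eq_mul, smul_eq_mul]
  exact Ideal.add_mem _ (Ideal.mul_mem_right _ _ (hf i)) (Ideal.mul_mem_right _ _ (hg i))

/-- **No common zero of `f, g` on the cone**: if `F = Σ fᵢ gᵢ` is a nonsingular form, a prime ideal
of `k[x₀, …, x_{n+1}]` containing every `fᵢ` and every `gᵢ` contains every variable (it contains
`F` and, by the Leibniz rule, all `∂ⱼF`). Geometrically: a common zero of the `fᵢ, gᵢ` would be a
singular point of `V₊(F)`. [folklore] -/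
theorem forall_X_mem_of_forall_mem (f g : ι → MvPolynomial (Fin (n + 2)) k)
    (hJ : SmoothHypersurface.IsNonsingularForm k (∑ i, f i * g i))
    {𝔭 : Ideal (MvPolynomial (Fin (n + 2)) k)} (h𝔭 : 𝔭.IsPrime) (hf : ∀ i, f i ∈ 𝔭)
    (hg : ∀ i, g i ∈ 𝔭) (j : Fin (n + 2)) : (MvPolynomial.X j : MvPolynomial (Fin (n + 2)) k) ∈ 𝔭 :=
  hJ 𝔭 h𝔭 (Ideal.sum_mem _ fun i _ => Ideal.mul_mem_left _ _ (hg i))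
    (pderiv_sum_mul_mem f g hf hg) j

/-- Contrapositive form: a prime ideal missing some variable misses some `fᵢ` or some `gᵢ`.
[folklore] -/
theorem exists_not_mem_or_not_mem_of_isNonsingularForm (f g : ι → MvPolynomial (Fin (n + 2)) k)
    (hJ : SmoothHypersurface.IsNonsingularForm k (∑ i, f i * g i))
    {𝔭 : Ideal (MvPolynomial (Fin (n + 2)) k)} (h𝔭 : 𝔭.IsPrime)
    (hX : ∃ j, (MvPolynomial.X j : MvPolynomial (Fin (n + 2)) k) ∉ 𝔭) :
    ∃ i, f i ∉ 𝔭 ∨ g i ∉ 𝔭 := by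
  by_contra! H
  obtain ⟨j, hj⟩ := hX
  exact hj (forall_X_mem_of_forall_mem f g hJ h𝔭 (fun i => (H i).1) (fun i => (H i).2) j)

/-- **The opens `{fᵢ ≠ 0}`, `{gᵢ ≠ 0}` cover `ℙⁿ⁺¹_k`** when `F = Σ fᵢ gᵢ` is nonsingular: every
relevant homogeneous prime misses some `fᵢ` or some `gᵢ` (a relevant prime misses some variable,
the variables generating the irrelevant ideal: `ProjectiveSpace.irrelevant_le_span`). [folklore] -/
theorem exists_not_mem_homogeneousIdeal (f g : ι → MvPolynomial (Fin (n + 2)) k)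
    (hJ : SmoothHypersurface.IsNonsingularForm k (∑ i, f i * g i)) :
    letI := MvPolynomial.gradedAlgebra (σ := Fin (n + 2)) (R := k)
    ∀ p : Proj (MvPolynomial.homogeneousSubmodule (Fin (n + 2)) k),
      ∃ i, f i ∉ p.asHomogeneousIdeal ∨ g i ∉ p.asHomogeneousIdeal := by
  letI := MvPolynomial.gradedAlgebra (σ := Fin (n + 2)) (R := k)
  intro p
  have hX : ∃ j, (MvPolynomial.X j : MvPolynomial (Fin (n + 2)) k) ∉ p.asHomogeneousIdeal := by
    by_contra! h
    refine p.not_irrelevant_le fun a ha => ?_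
    exact Ideal.span_le.mpr (Set.range_subset_iff.mpr h)
      (ProjectiveSpace.irrelevant_le_span (n + 1) k ha)
  obtain ⟨i, hi⟩ := exists_not_mem_or_not_mem_of_isNonsingularForm f g hJ p.isPrime hX
  exact ⟨i, hi⟩

/-- The same cover read on the points of `ℙⁿ⁺¹_k`: every point lies in some basic open `D₊(fᵢ)`
or `D₊(gᵢ)`. [folklore] -/
theorem exists_mem_basicOpen (f g : ι → MvPolynomial (Fin (n + 2)) k)
    (hJ : SmoothHypersurface.IsNonsingularForm k (∑ i, f i * g i)) :
    letI := MvPolynomial.gradedAlgebra (σ := Fin (n + 2)) (R := k)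
    ∀ p : Proj (MvPolynomial.homogeneousSubmodule (Fin (n + 2)) k),
      ∃ i, p ∈ Proj.basicOpen (MvPolynomial.homogeneousSubmodule (Fin (n + 2)) k) (f i) ∨
        p ∈ Proj.basicOpen (MvPolynomial.homogeneousSubmodule (Fin (n + 2)) k) (g i) := by
  letI := MvPolynomial.gradedAlgebra (σ := Fin (n + 2)) (R := k)
  intro p
  simp only [Proj.mem_basicOpen]
  exact exists_not_mem_homogeneousIdeal f g hJ p

end Cover

end Summit.HodgeConjecture.HodgeConjecture.Theorems.SemiregularSeedsOnAnchors.GorensteinCiSeeds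

end
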